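import Literature.Topology.FourManifolds.MappingTorusProofs
import Literature.Topology.FourManifolds.GluingCharts
import Mathlib.Topology.Algebra.Module.FiniteDimension
import Mathlib.Analysis.InnerProductSpace.PiL2
import HarnessLib

/-!
# Mapping tori: the smooth structure (trunk T-4MAN, prelude `FourManM`)

Second sibling proof file of `Literature.Topology.FourManifolds.MappingTorus` (D-0014: named
facts `def X : Prop` are discharged as `theorem X_holds : X`; the first sibling
`MappingTorusProofs` discharges `nonempty_homeomorph_mappingTorus_of_isMappingTorusOf`). It
discharges

* `Literature.exists_isMappingTorusOf_holds : exists_isMappingTorusOf` — a self-diffeomorphism `φ` of a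
  closed smooth `n`-manifold `M` (charted over `EuclideanSpace ℝ (Fin n)`) has a smooth mapping
  torus which is a closed smooth `(n + 1)`-manifold, in the relational sense
  `Literature.Topology.FourManifolds.IsMappingTorusOf` (an open gluing of the cylinders `M × (0, 1)` and `M × (1/2, 3/2)`
  along `Literature.mappingTorusRel φ`);
* `Literature.t2Space_mappingTorus_holds : t2Space_mappingTorus φ` — the mapping torus of a
  homeomorphism of a Hausdorff space is Hausdorff.

## Sources and what they print

Hatcher, *Algebraic Topology* (2002), Ch. 2 Example 2.48 (and Ch. 1 §1.3 for the covering
`M × ℝ → T_φ` and its deck transformations) *defines* the mapping torus; Cappell–Shaneson,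
*Some new four-manifolds*, Ann. of Math. 104 (1976), §1, use `M × ℝ / (x, t) ∼ (φ x, t + 1)` as
a smooth manifold without comment. The smooth structure is the standard one on the quotient of
a manifold by a discrete group acting smoothly, freely and properly (Lee, *Introduction to
Smooth Manifolds*, 2nd ed., Thm. 21.13), equivalently the structure glued from the two cylinder
charts (Lee, Lemma 1.35 "smooth manifold chart lemma"; Hirsch, *Differential Topology*, Ch. 8
§2 "Gluing manifolds together", p. 184). No source prints the verification for this particular
atlas; we record it here.

## The construction

The total space is the topological mapping torus `T := MappingTorus φ`
(`Literature.Topology.FourManifolds.MappingTorus`), which is compact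
(`compactSpace_mappingTorus`), second countable (`MappingTorus.secondCountableTopology`, the
quotient map being open, `MappingTorus.isOpenMap_mk` of `MappingTorusProofs`) and Hausdorff
(`MappingTorus.t2Space`: classes in different fibres are separated by the bundle projection to
`ℝ/ℤ`, classes in the same fibre by saturated boxes `U × (s - ½, s + ½)`).
1. The two cylinder maps `qA : M × (0, 1) → T`, `qB : M × (1/2, 3/2) → T` induced by the
   quotient map are open topological embeddings covering `T`
   (`MappingTorus.isOpenEmbedding_mk_pieceOne/Two`, `range_mk_pieceOne_union_range_mk_pieceTwo`),
   i.e. an `Literature.Topology.FourManifolds.IsOpenCover₂` (`MappingTorus.isOpenCover₂`), and they identify exactly the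
   `mappingTorusRel φ`-related points (`MappingTorus.mk_eq_mk_iff_mappingTorusRel`, proved in
   `MappingTorus.lean`).
2. The transition map `qB⁻¹ ∘ qA`, defined on `M × ((0, ½) ∪ (½, 1))`, is `(x, s) ↦ (x, s)` on
   `s > ½` and `(x, s) ↦ (φ x, s + 1)` on `s < ½` (`inr_symm_mk_of_lt/gt`); its inverse is
   `(y, t) ↦ (y, t)` on `t < 1` and `(y, t) ↦ (φ⁻¹ y, t - 1)` on `t > 1`
   (`inl_symm_mk_of_lt/gt`). Both are `C^∞` when `φ` is a diffeomorphism
   (`MappingTorus.contMDiffOn_transition`, `contMDiffOn_transition_symm`).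
3. Gluing the product atlases of the two cylinders along this cover
   (`Literature.Topology.FourManifolds.GluingCharts`, `IsOpenCover₂.chartedSpace`,
   `IsOpenCover₂.isManifold`) through a homeomorphism of model spaces `f : H × ℝ ≃ₜ H'` which
   reads as a continuous linear isomorphism `L : E × ℝ ≃L[ℝ] E'` in the models gives a `C^∞`
   structure on `T` over `(E', H')` (`MappingTorus.isManifold`) for which `qA`, `qB` are smooth
   open embeddings (`IsOpenCover₂.isSmoothEmbedding_left/right`). For `M` modelled on
   `EuclideanSpace ℝ (Fin n)` we take `L : EuclideanSpace ℝ (Fin n) × ℝ ≃L[ℝ]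
   EuclideanSpace ℝ (Fin (n + 1))` any linear isomorphism (the dimensions agree,
   `ContinuousLinearEquiv.ofFinrankEq`) and `f := L`.

Everything in this file is proved; it declares no definitions (the glued `ChartedSpace`
structure is the term `(MappingTorus.isOpenCover₂ φ).chartedSpace f` of `GluingCharts`).

Relation to `Literature.Topology.FourManifolds.GluingConstruction`. That file builds, from a
gluing datum `e : A ⇀ B` (`Literature.Topology.FourManifolds.SmoothGlueData`), the abstract pushout `d.Glued` with its smooth
structure, and would equally discharge the *existential* fact `exists_isMappingTorusOf`. Here we
instead put the smooth structure on the *given* quotient space `MappingTorus φ = M × ℝ / ℤ` via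
the chart lemma of `GluingCharts` (division of labour: given-space chart lemma there and here,
pushout construction in `GluingConstruction`), so that `MappingTorus.isManifold`,
`isSmoothEmbedding_mk_pieceOne/Two` and `MappingTorus.isMappingTorusOf` are available for the
concrete mapping torus and for an arbitrary model `I` of `M` (e.g. the `3`-torus over its own
model), not only for `𝓡 n`.

Sources: A. Hatcher, *Algebraic Topology* (2002), Ch. 2 Ex. 2.48, §1.3 and Prop. 1.40
[HatcherAT2002]; S. Cappell, J. Shaneson, *Some new four-manifolds*, Ann. of Math. 104 (1976),
§1 [CappellShaneson1976]; J. M. Lee, *Introduction to Smooth Manifolds*, 2nd ed. (2013),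
Lemma 1.35 and Thm. 21.13 [Lee2013]; M. Hirsch, *Differential Topology* (1976), Ch. 8 §2,
p. 184 [Hirsch1976].
-/

open scoped Manifold ContDiff Topology
open Set Function Topology

noncomputable section

namespace Literature.Topology.FourManifolds

namespace MappingTorus

/-! ### Topology of the mapping torus: second countable, Hausdorff -/

section Topological

variable {M : Type*} [TopologicalSpace M] (φ : M ≃ₜ M)

/-- The mapping torus of a homeomorphism of a second countable space is second countable: it is
the image of `M × ℝ` under the open quotient map `mk` (`MappingTorus.isOpenMap_mk`,
`Topology.IsQuotientMap.secondCountableTopology`) (Hatcher, *Algebraic Topology*, Ex. 2.48).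
[folklore] -/
theorem secondCountableTopology [SecondCountableTopology M] :
    SecondCountableTopology (MappingTorus φ) :=
  (isQuotientMap_mk φ).secondCountableTopology (isOpenMap_mk φ)

/-- **The mapping torus of a homeomorphism of a Hausdorff space is Hausdorff.** Two classes with
different image under the bundle projection to the Hausdorff circle `ℝ/ℤ` are separated by it;
two distinct classes `[(x, s)] ≠ [(y, s)]` in the same fibre are separated by the (open, by
`isOpenMap_mk`) images of `U × (s - ½, s + ½)` and `V × (s - ½, s + ½)` for disjoint open
`U ∋ x`, `V ∋ y`, which are disjoint because two levels less than `1` apart with the same class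
are equal (`mk_eq_mk_iff_of_abs_sub_lt_one`) (Hatcher, *Algebraic Topology*, Prop. 1.40 and
Ex. 2.48). [cite: HatcherAT2002, Prop. 1.40 and Ex. 2.48] -/
theorem t2Space [T2Space M] : T2Space (MappingTorus φ) := by
  refine ⟨fun p q hpq => ?_⟩
  obtain ⟨⟨x, s⟩, rfl⟩ := mk_surjective φ p
  obtain ⟨⟨y, t⟩, rfl⟩ := mk_surjective φ q
  simp only at hpq ⊢
  by_cases hst : ((s : ℝ) : AddCircle (1 : ℝ)) = t
  · obtain ⟨k, hk⟩ : ∃ k : ℤ, t = s + k := by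
      have : ((t - s : ℝ) : AddCircle (1 : ℝ)) = 0 := by rw [AddCircle.coe_sub, hst, sub_self]
      obtain ⟨k, hk⟩ := (AddCircle.coe_eq_zero_iff (1 : ℝ)).1 this
      exact ⟨k, by rw [zsmul_eq_mul, mul_one] at hk; linarith⟩
    have hq : mk φ y t = mk φ ((φ.toEquiv ^ k).symm y) s := by
      rw [← mk_zpow_apply_add_intCast φ ((φ.toEquiv ^ k).symm y) s k, Equiv.apply_symm_apply, hk]
    rw [hq] at hpq ⊢
    set y' := (φ.toEquiv ^ k).symm y
    have hxy : x ≠ y' := fun h => hpq (by rw [h])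
    obtain ⟨U, V, hU, hV, hxU, hyV, hUV⟩ := t2_separation hxy
    have hsO : s ∈ Ioo (s - 2⁻¹) (s + 2⁻¹) := ⟨by linarith, by linarith⟩
    refine ⟨(fun p : M × ℝ => mk φ p.1 p.2) '' (U ×ˢ Ioo (s - 2⁻¹) (s + 2⁻¹)),
      (fun p : M × ℝ => mk φ p.1 p.2) '' (V ×ˢ Ioo (s - 2⁻¹) (s + 2⁻¹)),
      isOpenMap_mk φ _ (hU.prod isOpen_Ioo), isOpenMap_mk φ _ (hV.prod isOpen_Ioo),
      ⟨(x, s), ⟨hxU, hsO⟩, rfl⟩, ⟨(y', s), ⟨hyV, hsO⟩, rfl⟩, ?_⟩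
    rw [Set.disjoint_left]
    rintro _ ⟨⟨a, σ⟩, ⟨haU, hσ⟩, rfl⟩ ⟨⟨b, τ⟩, ⟨hbV, hτ⟩, hab⟩
    have hab' : mk φ b τ = mk φ a σ := hab
    have habs : |σ - τ| < 1 :=
      abs_sub_lt_iff.2 ⟨by linarith [hσ.2, hτ.1], by linarith [hσ.1, hτ.2]⟩
    obtain ⟨rfl, -⟩ := (mk_eq_mk_iff_of_abs_sub_lt_one φ habs).1 hab'
    exact Set.disjoint_left.1 hUV haU hbV
  · exact separated_by_continuous (continuous_proj φ) (by simpa using hst)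

end Topological

/-! ### The two cylinders -/

/-- Membership in the first cylinder base `(0, 1)`. [folklore] -/
theorem mem_mappingTorusPieceOne {t : ℝ} : t ∈ mappingTorusPieceOne ↔ 0 < t ∧ t < 1 := by
  rw [← SetLike.mem_coe, coe_mappingTorusPieceOne, mem_Ioo]

/-- Membership in the second cylinder base `(1/2, 3/2)`. [folklore] -/
theorem mem_mappingTorusPieceTwo {t : ℝ} : t ∈ mappingTorusPieceTwo ↔ 1 / 2 < t ∧ t < 3 / 2 := by
  rw [← SetLike.mem_coe, coe_mappingTorusPieceTwo, mem_Ioo]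

/-- The first cylinder base `(0, 1)` is nonempty (it contains `1/2`). Stated as a theorem, not an
instance; used through `haveI`. [folklore] -/
theorem nonempty_mappingTorusPieceOne : Nonempty mappingTorusPieceOne :=
  ⟨⟨2⁻¹, mem_mappingTorusPieceOne.2 ⟨by norm_num, by norm_num⟩⟩⟩

/-- The second cylinder base `(1/2, 3/2)` is nonempty (it contains `1`). [folklore] -/
theorem nonempty_mappingTorusPieceTwo : Nonempty mappingTorusPieceTwo :=
  ⟨⟨1, mem_mappingTorusPieceTwo.2 ⟨by norm_num, by norm_num⟩⟩⟩

section Cylinders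

variable {M : Type*} [TopologicalSpace M] (φ : M ≃ₜ M)

/-- The first cylinder map `M × (0, 1) → T_φ`, `(x, s) ↦ [(x, s)]`, is an open topological
embedding: it is continuous, injective and open (`continuous_mk_pieceOne`,
`injective_mk_pieceOne`, `isOpenMap_mk_pieceOne` of `MappingTorusProofs`)
(Hatcher, *Algebraic Topology*, Ex. 2.48). [folklore] -/
theorem isOpenEmbedding_mk_pieceOne :
    IsOpenEmbedding fun a : M × mappingTorusPieceOne => mk φ a.1 a.2 :=
  .of_continuous_injective_isOpenMap (continuous_mk_pieceOne φ) (injective_mk_pieceOne φ)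
    (isOpenMap_mk_pieceOne φ)

/-- The second cylinder map `M × (1/2, 3/2) → T_φ`, `(y, t) ↦ [(y, t)]`, is an open topological
embedding (Hatcher, *Algebraic Topology*, Ex. 2.48). [folklore] -/
theorem isOpenEmbedding_mk_pieceTwo :
    IsOpenEmbedding fun b : M × mappingTorusPieceTwo => mk φ b.1 b.2 :=
  .of_continuous_injective_isOpenMap (continuous_mk_pieceTwo φ) (injective_mk_pieceTwo φ)
    (isOpenMap_mk_pieceTwo φ)

/-- Every class has a representative with `t ∈ (0, 1)` or with `t = 1` (from `t = 0` via
`(x, 0) ∼ (φ x, 1)`), so the two cylinders cover the mapping torus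
(Hatcher, *Algebraic Topology*, Ex. 2.48). [folklore] -/
theorem range_mk_pieceOne_union_range_mk_pieceTwo :
    range (fun a : M × mappingTorusPieceOne => mk φ a.1 a.2) ∪
      range (fun b : M × mappingTorusPieceTwo => mk φ b.1 b.2) = univ := by
  refine eq_univ_of_forall fun z => ?_
  obtain ⟨x, t, ht, rfl⟩ := exists_mk_eq_of_mem_Ico φ z
  rcases ht.1.eq_or_lt with h0 | h0
  · right
    refine ⟨(φ x, ⟨1, mem_mappingTorusPieceTwo.2 ⟨by norm_num, by norm_num⟩⟩), ?_⟩
    rw [← h0]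
    simpa using mk_apply_add_one φ x 0
  · left
    exact ⟨(x, ⟨t, mem_mappingTorusPieceOne.2 ⟨h0, ht.2⟩⟩), rfl⟩

/-- **The two cylinders form an open cover of the mapping torus** (`Literature.Topology.FourManifolds.IsOpenCover₂`): the maps
`M × (0, 1) → T_φ`, `M × (1/2, 3/2) → T_φ` induced by the quotient map are open embeddings whose
ranges cover `T_φ` (Hatcher, *Algebraic Topology*, Ex. 2.48; Cappell–Shaneson 1976, §1).
[folklore] -/
theorem isOpenCover₂ :
    IsOpenCover₂ (fun a : M × mappingTorusPieceOne => mk φ a.1 a.2)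
      (fun b : M × mappingTorusPieceTwo => mk φ b.1 b.2) :=
  ⟨isOpenEmbedding_mk_pieceOne φ, isOpenEmbedding_mk_pieceTwo φ,
    range_mk_pieceOne_union_range_mk_pieceTwo φ⟩

section InrSymm

variable [Nonempty (M × mappingTorusPieceTwo)]

/-- On `s > 1/2` the transition map `qB⁻¹ ∘ qA` of the two cylinders is `(x, s) ↦ (x, s)`.
[folklore] -/
theorem inr_symm_mk_of_lt (a : M × mappingTorusPieceOne) (ha : 1 / 2 < (a.2 : ℝ)) :
    (isOpenCover₂ φ).inr.symm (mk φ a.1 a.2) =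
      (a.1, ⟨a.2, mem_mappingTorusPieceTwo.2
        ⟨ha, by linarith [(mem_mappingTorusPieceOne.1 a.2.2).2]⟩⟩) := by
  have h : mk φ a.1 a.2 = (fun b : M × mappingTorusPieceTwo => mk φ b.1 b.2)
      (a.1, ⟨a.2, mem_mappingTorusPieceTwo.2
        ⟨ha, by linarith [(mem_mappingTorusPieceOne.1 a.2.2).2]⟩⟩) := rfl
  exact ((isOpenCover₂ φ).inr_symm_apply_eq_iff ⟨_, h.symm⟩).2 h

/-- On `s < 1/2` the transition map `qB⁻¹ ∘ qA` of the two cylinders is `(x, s) ↦ (φ x, s + 1)`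
(the direction convention `(x, s) ∼ (φ x, s + 1)`, `MappingTorus.mk_apply_add_one`). [folklore] -/
theorem inr_symm_mk_of_gt (a : M × mappingTorusPieceOne) (ha : (a.2 : ℝ) < 1 / 2) :
    (isOpenCover₂ φ).inr.symm (mk φ a.1 a.2) =
      (φ a.1, ⟨a.2 + 1, mem_mappingTorusPieceTwo.2
        ⟨by linarith [(mem_mappingTorusPieceOne.1 a.2.2).1], by linarith⟩⟩) := by
  have h : mk φ a.1 a.2 = (fun b : M × mappingTorusPieceTwo => mk φ b.1 b.2)
      (φ a.1, ⟨a.2 + 1, mem_mappingTorusPieceTwo.2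
        ⟨by linarith [(mem_mappingTorusPieceOne.1 a.2.2).1], by linarith⟩⟩) :=
    (mk_apply_add_one φ a.1 a.2).symm
  exact ((isOpenCover₂ φ).inr_symm_apply_eq_iff ⟨_, h.symm⟩).2 h

end InrSymm

section InlSymm

variable [Nonempty (M × mappingTorusPieceOne)]

/-- On `t < 1` the inverse transition map `qA⁻¹ ∘ qB` is `(y, t) ↦ (y, t)`. [folklore] -/
theorem inl_symm_mk_of_lt (b : M × mappingTorusPieceTwo) (hb : (b.2 : ℝ) < 1) :
    (isOpenCover₂ φ).inl.symm (mk φ b.1 b.2) =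
      (b.1, ⟨b.2, mem_mappingTorusPieceOne.2
        ⟨by linarith [(mem_mappingTorusPieceTwo.1 b.2.2).1], hb⟩⟩) := by
  have h : mk φ b.1 b.2 = (fun a : M × mappingTorusPieceOne => mk φ a.1 a.2)
      (b.1, ⟨b.2, mem_mappingTorusPieceOne.2
        ⟨by linarith [(mem_mappingTorusPieceTwo.1 b.2.2).1], hb⟩⟩) := rfl
  exact ((isOpenCover₂ φ).inl_symm_apply_eq_iff ⟨_, h.symm⟩).2 h

/-- On `t > 1` the inverse transition map `qA⁻¹ ∘ qB` is `(y, t) ↦ (φ⁻¹ y, t - 1)`. [folklore] -/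
theorem inl_symm_mk_of_gt (b : M × mappingTorusPieceTwo) (hb : 1 < (b.2 : ℝ)) :
    (isOpenCover₂ φ).inl.symm (mk φ b.1 b.2) =
      (φ.symm b.1, ⟨b.2 - 1, mem_mappingTorusPieceOne.2
        ⟨by linarith, by linarith [(mem_mappingTorusPieceTwo.1 b.2.2).2]⟩⟩) := by
  have h : mk φ b.1 b.2 = (fun a : M × mappingTorusPieceOne => mk φ a.1 a.2)
      (φ.symm b.1, ⟨b.2 - 1, mem_mappingTorusPieceOne.2
        ⟨by linarith, by linarith [(mem_mappingTorusPieceTwo.1 b.2.2).2]⟩⟩) := by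
    have := mk_apply_add_one φ (φ.symm b.1) (b.2 - 1)
    rw [Homeomorph.apply_symm_apply, sub_add_cancel] at this
    exact this
  exact ((isOpenCover₂ φ).inl_symm_apply_eq_iff ⟨_, h.symm⟩).2 h

end InlSymm

end Cylinders

/-! ### Smoothness of the transition maps -/

section Smooth

variable {E H : Type*} [NormedAddCommGroup E] [NormedSpace ℝ E] [TopologicalSpace H]
  {I : ModelWithCorners ℝ E H} {M : Type*} [TopologicalSpace M] [ChartedSpace H M]

/-- A map between cylinders `M × U → M × V` (`U`, `V` open in `ℝ`) which on a set `S` has the form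
`(x, t) ↦ (ψ x, t + c)` with `ψ` smooth is smooth on `S`. [folklore] -/
theorem contMDiffOn_of_apply_eq {U V : TopologicalSpace.Opens ℝ} {ψ : M → M}
    (hψ : ContMDiff I I ∞ ψ) (c : ℝ) {g : M × U → M × V} {S : Set (M × U)}
    (hg : ∀ a ∈ S, (g a).1 = ψ a.1 ∧ ((g a).2 : ℝ) = a.2 + c) :
    ContMDiffOn (I.prod 𝓘(ℝ, ℝ)) (I.prod 𝓘(ℝ, ℝ)) ∞ g S := by
  rw [contMDiffOn_prod_iff]
  constructor
  · exact (hψ.comp_contMDiffOn contMDiffOn_fst).congr fun a ha => (hg a ha).1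
  · intro a ha
    rw [← ContMDiffWithinAt.subtypeVal_comp_iff]
    have h2 : ContMDiff (I.prod 𝓘(ℝ, ℝ)) 𝓘(ℝ, ℝ) ∞ fun a : M × U => (a.2 : ℝ) + c :=
      ((contDiff_id.add contDiff_const).contMDiff).comp
        (contMDiff_subtype_val.comp contMDiff_snd)
    exact (h2.contMDiffOn.congr fun a ha => (hg a ha).2) a ha

variable (φ : M ≃ₘ⟮I, I⟯ M) [Nonempty (M × mappingTorusPieceOne)]
  [Nonempty (M × mappingTorusPieceTwo)]

/-- **The transition map of the two cylinders is smooth.** On its source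
`qA ⁻¹' (range qB) = M × ((0, ½) ∪ (½, 1))` the map `qB⁻¹ ∘ qA` is `(x, s) ↦ (x, s)` for `s > ½`
and `(x, s) ↦ (φ x, s + 1)` for `s < ½`, both smooth for a diffeomorphism `φ` (Cappell–Shaneson
1976, §1; Lee, *Introduction to Smooth Manifolds*, Thm. 21.13). [cite: CappellShaneson1976, §1] -/
theorem contMDiffOn_transition :
    ContMDiffOn (I.prod 𝓘(ℝ, ℝ)) (I.prod 𝓘(ℝ, ℝ)) ∞
      ((isOpenCover₂ φ.toHomeomorph).inl ≫ₕ (isOpenCover₂ φ.toHomeomorph).inr.symm)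
      ((isOpenCover₂ φ.toHomeomorph).inl ≫ₕ (isOpenCover₂ φ.toHomeomorph).inr.symm).source := by
  set h := isOpenCover₂ (M := M) φ.toHomeomorph
  have hS₁ : IsOpen {a : M × mappingTorusPieceOne | 1 / 2 < (a.2 : ℝ)} :=
    isOpen_lt continuous_const (continuous_subtype_val.comp continuous_snd)
  have hS₂ : IsOpen {a : M × mappingTorusPieceOne | (a.2 : ℝ) < 1 / 2} :=
    isOpen_lt (continuous_subtype_val.comp continuous_snd) continuous_const
  have h₁ : ContMDiffOn (I.prod 𝓘(ℝ, ℝ)) (I.prod 𝓘(ℝ, ℝ)) ∞ (h.inl ≫ₕ h.inr.symm)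
      {a : M × mappingTorusPieceOne | 1 / 2 < (a.2 : ℝ)} := by
    refine contMDiffOn_of_apply_eq contMDiff_id 0 fun a ha => ?_
    have hha : (h.inl ≫ₕ h.inr.symm) a = h.inr.symm (mk φ.toHomeomorph a.1 a.2) := rfl
    rw [hha, inr_symm_mk_of_lt _ a ha]
    simp
  have h₂ : ContMDiffOn (I.prod 𝓘(ℝ, ℝ)) (I.prod 𝓘(ℝ, ℝ)) ∞ (h.inl ≫ₕ h.inr.symm)
      {a : M × mappingTorusPieceOne | (a.2 : ℝ) < 1 / 2} := by
    refine contMDiffOn_of_apply_eq φ.contMDiff 1 fun a ha => ?_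
    have hha : (h.inl ≫ₕ h.inr.symm) a = h.inr.symm (mk φ.toHomeomorph a.1 a.2) := rfl
    rw [hha, inr_symm_mk_of_gt _ a ha]
    simp
  intro a ha
  rw [IsOpenCover₂.inl_trans_inr_symm_source, mem_preimage] at ha
  obtain ⟨b, hb⟩ := ha
  have hb' : mk φ.toHomeomorph a.1 a.2 = mk φ.toHomeomorph b.1 b.2 := hb.symm
  rcases (mk_eq_mk_iff_mappingTorusRel φ.toHomeomorph a b).1 hb' with ⟨hba, -⟩ | ⟨hba, -⟩
  · have ha : 1 / 2 < (a.2 : ℝ) := hba ▸ (mem_mappingTorusPieceTwo.1 b.2.2).1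
    exact (h₁.contMDiffAt (hS₁.mem_nhds ha)).contMDiffWithinAt
  · have ha : (a.2 : ℝ) < 1 / 2 := by linarith [(mem_mappingTorusPieceTwo.1 b.2.2).2]
    exact (h₂.contMDiffAt (hS₂.mem_nhds ha)).contMDiffWithinAt

/-- **The inverse transition map of the two cylinders is smooth**: `qA⁻¹ ∘ qB` is
`(y, t) ↦ (y, t)` for `t < 1` and `(y, t) ↦ (φ⁻¹ y, t - 1)` for `t > 1`
(Cappell–Shaneson 1976, §1). [folklore] -/
theorem contMDiffOn_transition_symm :
    ContMDiffOn (I.prod 𝓘(ℝ, ℝ)) (I.prod 𝓘(ℝ, ℝ)) ∞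
      ((isOpenCover₂ φ.toHomeomorph).inl ≫ₕ (isOpenCover₂ φ.toHomeomorph).inr.symm).symm
      ((isOpenCover₂ φ.toHomeomorph).inl ≫ₕ (isOpenCover₂ φ.toHomeomorph).inr.symm).target := by
  set h := isOpenCover₂ (M := M) φ.toHomeomorph
  rw [← OpenPartialHomeomorph.symm_source, OpenPartialHomeomorph.trans_symm_eq_symm_trans_symm,
    OpenPartialHomeomorph.symm_symm]
  have hS₁ : IsOpen {b : M × mappingTorusPieceTwo | (b.2 : ℝ) < 1} :=
    isOpen_lt (continuous_subtype_val.comp continuous_snd) continuous_const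
  have hS₂ : IsOpen {b : M × mappingTorusPieceTwo | 1 < (b.2 : ℝ)} :=
    isOpen_lt continuous_const (continuous_subtype_val.comp continuous_snd)
  have h₁ : ContMDiffOn (I.prod 𝓘(ℝ, ℝ)) (I.prod 𝓘(ℝ, ℝ)) ∞ (h.inr ≫ₕ h.inl.symm)
      {b : M × mappingTorusPieceTwo | (b.2 : ℝ) < 1} := by
    refine contMDiffOn_of_apply_eq contMDiff_id 0 fun b hb => ?_
    have hhb : (h.inr ≫ₕ h.inl.symm) b = h.inl.symm (mk φ.toHomeomorph b.1 b.2) := rfl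
    rw [hhb, inl_symm_mk_of_lt _ b hb]
    simp
  have h₂ : ContMDiffOn (I.prod 𝓘(ℝ, ℝ)) (I.prod 𝓘(ℝ, ℝ)) ∞ (h.inr ≫ₕ h.inl.symm)
      {b : M × mappingTorusPieceTwo | 1 < (b.2 : ℝ)} := by
    refine contMDiffOn_of_apply_eq φ.symm.contMDiff (-1) fun b hb => ?_
    have hhb : (h.inr ≫ₕ h.inl.symm) b = h.inl.symm (mk φ.toHomeomorph b.1 b.2) := rfl
    rw [hhb, inl_symm_mk_of_gt _ b hb]
    simp [sub_eq_add_neg]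
  intro b hb
  have hb' : mk φ.toHomeomorph b.1 b.2 ∈
      range (fun a : M × mappingTorusPieceOne => mk φ.toHomeomorph a.1 a.2) := by
    simpa [OpenPartialHomeomorph.trans_source] using hb
  obtain ⟨a, ha⟩ := hb'
  have ha' : mk φ.toHomeomorph a.1 a.2 = mk φ.toHomeomorph b.1 b.2 := ha
  rcases (mk_eq_mk_iff_mappingTorusRel φ.toHomeomorph a b).1 ha' with ⟨hba, -⟩ | ⟨hba, -⟩
  · have hb : (b.2 : ℝ) < 1 := hba ▸ (mem_mappingTorusPieceOne.1 a.2.2).2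
    exact (h₁.contMDiffAt (hS₁.mem_nhds hb)).contMDiffWithinAt
  · have hb : 1 < (b.2 : ℝ) := by
      rw [hba]; linarith [(mem_mappingTorusPieceOne.1 a.2.2).1]
    exact (h₂.contMDiffAt (hS₂.mem_nhds hb)).contMDiffWithinAt

end Smooth

/-! ### The smooth structure -/

section Manifold

variable {E H : Type*} [NormedAddCommGroup E] [NormedSpace ℝ E] [TopologicalSpace H]
  {I : ModelWithCorners ℝ E H} {M : Type*} [TopologicalSpace M] [ChartedSpace H M]
  {E' H' : Type*} [NormedAddCommGroup E'] [NormedSpace ℝ E'] [TopologicalSpace H']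
  {I' : ModelWithCorners ℝ E' H'}

/-- **The mapping torus of a diffeomorphism is a smooth manifold.** Let `M` be a `C^∞` manifold
over `(E, H)` and `φ` a diffeomorphism of `M`; let `f : H × ℝ ≃ₜ H'` be a homeomorphism of model
spaces reading as a continuous linear isomorphism `L : E × ℝ ≃L[ℝ] E'` through the models with
corners `I.prod 𝓘(ℝ, ℝ)` and `I'`. Then `T_φ`, with the `ChartedSpace H'` structure glued from the
product atlases of the cylinders `M × (0, 1)`, `M × (1/2, 3/2)` and re-modelled through `f`
(`(isOpenCover₂ φ).chartedSpace f`, a term, not an instance), is a `C^∞` manifold over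
`(E', H')`: the transition maps of the cover are smooth (`contMDiffOn_transition(_symm)`) and
`GluingCharts` applies (Lee, *Introduction to Smooth Manifolds*, Lemma 1.35, and Thm. 21.13 —
quotient of a manifold by a discrete group acting smoothly, freely and properly, here `ℤ` on
`M × ℝ`; Hirsch, *Differential Topology*, Ch. 8 §2).
[cite: Lee2013, Thm. 21.13] [cite: Hirsch1976, Ch. 8 §2, p. 184] -/
theorem isManifold [IsManifold I ∞ M] (φ : M ≃ₘ⟮I, I⟯ M) (f : ModelProd H ℝ ≃ₜ H')
    (L : (E × ℝ) ≃L[ℝ] E') (hIf : ∀ x, I' (f x) = L ((I.prod 𝓘(ℝ, ℝ)) x)) :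
    @IsManifold ℝ _ E' _ _ H' _ I' ∞ (MappingTorus φ.toHomeomorph) _
      ((isOpenCover₂ φ.toHomeomorph).chartedSpace f) := by
  refine (isOpenCover₂ φ.toHomeomorph).isManifold f
    (Homeomorph.contMDiff_of_apply_eq_linear f L hIf)
    (Homeomorph.contMDiff_of_apply_eq_linear f.symm L.symm
      (Homeomorph.symm_apply_eq_linear f L hIf)) ?_
  intro _ _
  exact ⟨contMDiffOn_transition φ, contMDiffOn_transition_symm φ⟩

/-- **The cylinders are smooth embeddings.** With the smooth structure of `isManifold`, the first
cylinder map `M × (0, 1) → T_φ` is a smooth open embedding (`Manifold.IsSmoothEmbedding`)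
(Hirsch, *Differential Topology*, Ch. 8 §2). [folklore] -/
theorem isSmoothEmbedding_mk_pieceOne [IsManifold I ∞ M] (φ : M ≃ₘ⟮I, I⟯ M)
    (f : ModelProd H ℝ ≃ₜ H') (L : (E × ℝ) ≃L[ℝ] E')
    (hIf : ∀ x, I' (f x) = L ((I.prod 𝓘(ℝ, ℝ)) x)) :
    letI := (isOpenCover₂ φ.toHomeomorph).chartedSpace f
    Manifold.IsSmoothEmbedding (I.prod 𝓘(ℝ, ℝ)) I' ∞
      fun a : M × mappingTorusPieceOne => mk φ.toHomeomorph a.1 a.2 :=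
  (isOpenCover₂ φ.toHomeomorph).isSmoothEmbedding_left f (isManifold φ f L hIf) L hIf

/-- With the smooth structure of `isManifold`, the second cylinder map `M × (1/2, 3/2) → T_φ` is a
smooth open embedding (Hirsch, *Differential Topology*, Ch. 8 §2). [folklore] -/
theorem isSmoothEmbedding_mk_pieceTwo [IsManifold I ∞ M] (φ : M ≃ₘ⟮I, I⟯ M)
    (f : ModelProd H ℝ ≃ₜ H') (L : (E × ℝ) ≃L[ℝ] E')
    (hIf : ∀ x, I' (f x) = L ((I.prod 𝓘(ℝ, ℝ)) x)) :
    letI := (isOpenCover₂ φ.toHomeomorph).chartedSpace f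
    Manifold.IsSmoothEmbedding (I.prod 𝓘(ℝ, ℝ)) I' ∞
      fun b : M × mappingTorusPieceTwo => mk φ.toHomeomorph b.1 b.2 :=
  (isOpenCover₂ φ.toHomeomorph).isSmoothEmbedding_right f (isManifold φ f L hIf) L hIf

/-- **A smooth mapping torus in the relational sense.** With the smooth structure of
`isManifold`, `T_φ = MappingTorus φ` *is* a mapping torus of `φ` (`Literature.Topology.FourManifolds.IsMappingTorusOf`): the two
cylinder maps are smooth open embeddings covering `T_φ` and identifying exactly the
`mappingTorusRel φ`-related points (`mk_eq_mk_iff_mappingTorusRel`) (Cappell–Shaneson 1976, §1).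
[cite: CappellShaneson1976, §1] -/
theorem isMappingTorusOf [IsManifold I ∞ M] (φ : M ≃ₘ⟮I, I⟯ M) (f : ModelProd H ℝ ≃ₜ H')
    (L : (E × ℝ) ≃L[ℝ] E') (hIf : ∀ x, I' (f x) = L ((I.prod 𝓘(ℝ, ℝ)) x)) :
    @IsMappingTorusOf E H _ _ _ I E' H' _ _ _ I' M _ _ (MappingTorus φ.toHomeomorph) _
      ((isOpenCover₂ φ.toHomeomorph).chartedSpace f) φ := by
  letI := (isOpenCover₂ φ.toHomeomorph).chartedSpace f
  refine ⟨fun a => mk φ.toHomeomorph a.1 a.2, fun b => mk φ.toHomeomorph b.1 b.2,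
    isSmoothEmbedding_mk_pieceOne φ f L hIf, (isOpenEmbedding_mk_pieceOne _).isOpen_range,
    isSmoothEmbedding_mk_pieceTwo φ f L hIf, (isOpenEmbedding_mk_pieceTwo _).isOpen_range,
    range_mk_pieceOne_union_range_mk_pieceTwo _, fun a b => ?_⟩
  rw [mk_eq_mk_iff_mappingTorusRel, Diffeomorph.coe_toHomeomorph]

end Manifold

end MappingTorus

/-! ### The named facts -/

/-- **Discharge of `t2Space_mappingTorus`**: the mapping torus of a homeomorphism of a Hausdorff
space is Hausdorff (`MappingTorus.t2Space`). [cite: HatcherAT2002, Prop. 1.40 and Ex. 2.48] -/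
theorem t2Space_mappingTorus_holds {M : Type*} [TopologicalSpace M] (φ : M ≃ₜ M) :
    t2Space_mappingTorus φ :=
  fun {_} => MappingTorus.t2Space φ

universe u

/-- **Discharge of `exists_isMappingTorusOf`** (Cappell–Shaneson, *Some new four-manifolds*,
Ann. of Math. 104 (1976), §1; Hatcher, *Algebraic Topology*, Ex. 2.48): a self-diffeomorphism
`φ` of a closed smooth `n`-manifold has a smooth mapping torus which is a closed smooth
`(n + 1)`-manifold, namely `T := MappingTorus φ` (compact, Hausdorff, second countable) with the
glued atlas of `MappingTorus.isManifold`, re-modelled on `EuclideanSpace ℝ (Fin (n + 1))` through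
any linear isomorphism `EuclideanSpace ℝ (Fin n) × ℝ ≃L[ℝ] EuclideanSpace ℝ (Fin (n + 1))`
(the dimensions agree); the two cylinders are smooth open embeddings covering `T` and identifying
exactly `mappingTorusRel`-related points (`MappingTorus.isMappingTorusOf`).
[cite: HatcherAT2002, Ex. 2.48] [cite: CappellShaneson1976, §1] -/
theorem exists_isMappingTorusOf_holds {n : ℕ} : exists_isMappingTorusOf.{u} (n := n) := by
  intro M _ _ _ _ _ _ φ
  obtain ⟨L⟩ : Nonempty ((EuclideanSpace ℝ (Fin n) × ℝ) ≃L[ℝ] EuclideanSpace ℝ (Fin (n + 1))) :=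
    ⟨ContinuousLinearEquiv.ofFinrankEq (by simp [Module.finrank_prod])⟩
  obtain ⟨f, hf⟩ : ∃ f : ModelProd (EuclideanSpace ℝ (Fin n)) ℝ ≃ₜ EuclideanSpace ℝ (Fin (n + 1)),
      ∀ x, (𝓡 (n + 1)) (f x) = L (((𝓡 n).prod 𝓘(ℝ, ℝ)) x) :=
    ⟨L.toHomeomorph, fun x => by
      show (𝓡 (n + 1)) (L x) = L (((𝓡 n).prod 𝓘(ℝ, ℝ)) x)
      simp [modelWithCorners_prod_coe]⟩
  exact ⟨MappingTorus φ.toHomeomorph, inferInstance, MappingTorus.t2Space _,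
    MappingTorus.secondCountableTopology _,
    (MappingTorus.isOpenCover₂ φ.toHomeomorph).chartedSpace f, MappingTorus.isManifold φ f L hf,
    inferInstance, MappingTorus.isMappingTorusOf φ f L hf⟩

end Literature.Topology.FourManifolds
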